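import Mathlib
import Summits.Ventures.HodgeRepro.Tier4.Common.ArchAssemble

/-!
# Tier4/Common/ArchAssembleProd — the PRODUCT FORMULA of the place split: a function multiplicative on a subgroup of
`G(𝔸)` evaluates on an assembled element as the product of its values on the `w`-slices

Blind re-derivation cell `pub-hodge-repro`, Tier 4 «prove the step» (README §9–§10), seat t4-typer-2 (gen 4), module 2 of
the offer S14892 (C-COMMON-ARCHSPLIT), on t4-L1-p5 g5's named consumer S15308 (i): the bridge `hmatch : ∀ t' : T′_∞,
χ′ t' = torusWeight' t'` from the per-place `ChiMatchesAt'` («`T′_∞ = ∏_w T′_w`»).  Target tree path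
`lean/Summits/Ventures/HodgeRepro/Tier4/Common/ArchAssembleProd.lean`.  Imports: Mathlib + `Common.ArchAssemble`
(`assemble`, `assemble_mul`, `assemble_one`, `ofPlace`, `assemble_ofPlace`, `ofPlace_mem_torusT(')`).

THE FORMULA.  `assembleOn s κ` is the assembled element of the family `κ` restricted to a finite set `s` of places (`1`
outside `s`); `assembleOn (insert a s) κ = ofPlace a (κ a) * assembleOn s κ` (`assemble_mul`), so by induction on `s` a
function `f` multiplicative on a subgroup `H` containing the slices satisfies
**`f (assemble κ) = ∏ w, f (ofPlace w (κ w))`** (`map_assemble_eq_prod`), and for `g ∈ G_∞` (`assemble_ofPlace`)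
**`f g = ∏ w, f (ofPlace w g)`** (`map_eq_prod_ofPlace_of_mem_infinitePart`); for a monoid homomorphism `χ : H →* M`
on a subgroup closed under slices (`torusT`, `torusT'`: `ofPlace_mem_torusT(')`) the same with the subtype
(`map_subtype_eq_prod_ofPlace`, `map_subtype_eq_prod_ofPlace_torusT'`, `map_subtype_eq_prod_ofPlace_torusT`).
Consumer shape (L1-p5): `χ′ t' = ∏_w χ′ (ofPlace w t') = ∏_w torusWeight' (ofPlace w t') = torusWeight' t'` with
`ofPlace w t' ∈ localTorusAt' W w` (`ofPlace_mem_localTorusAt'`) for the per-place matching.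

Nothing here says anything about the status of the Hodge conjecture for CM abelian varieties, which is NOT proved
(HC_CM is NOT proved by anyone in this repository).
-/

set_option autoImplicit false

noncomputable section

namespace Summit.Ventures.HodgeRepro.Tier4.Common

open NumberField Summit.Ventures.HodgeRepro.Tier4.Line1
open scoped Classical

section Prod

variable {k : Type} [Field k] [NumberField k] (W : PlaneData k)

/-- **The assembled element of `κ` restricted to the places in `s`** (`1` outside `s`). -/
def assembleOn (s : Finset (InfinitePlace k)) (κ : InfinitePlace k → GA W) : GA W :=
  assemble W fun w => if w ∈ s then κ w else 1

/-- Restricting to no place assembles `1`. -/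
theorem assembleOn_empty (κ : InfinitePlace k → GA W) : assembleOn W ∅ κ = 1 := by
  rw [assembleOn]
  simp only [Finset.notMem_empty, if_false]
  exact assemble_one W

/-- Restricting to every place is assembling. -/
theorem assembleOn_univ (κ : InfinitePlace k → GA W) : assembleOn W Finset.univ κ = assemble W κ := by
  rw [assembleOn]
  simp only [Finset.mem_univ, if_true]

/-- **Inserting a place splits off its slice**: `assembleOn (insert a s) κ = ofPlace a (κ a) * assembleOn s κ`. -/
theorem assembleOn_insert {s : Finset (InfinitePlace k)} {a : InfinitePlace k} (ha : a ∉ s)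
    (κ : InfinitePlace k → GA W) : assembleOn W (insert a s) κ = ofPlace W a (κ a) * assembleOn W s κ := by
  rw [assembleOn, assembleOn, ofPlace, ← assemble_mul]
  congr 1
  funext w
  by_cases h : w = a
  · subst h
    rw [if_pos (Finset.mem_insert_self _ _), if_pos rfl, if_neg ha, mul_one]
  · rw [if_neg h, one_mul]
    simp only [Finset.mem_insert, h, false_or]

/-- **The product formula on a finite set of places**: a function `f` multiplicative on a subgroup `H` containing the
slices `ofPlace w (κ w)` satisfies `f (assembleOn s κ) = ∏ w ∈ s, f (ofPlace w (κ w))`, and `assembleOn s κ ∈ H`. -/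
theorem mem_and_map_assembleOn_eq_prod {M : Type} [CommMonoid M] (H : Subgroup (GA W)) (f : GA W → M)
    (hf : ∀ x ∈ H, ∀ y ∈ H, f (x * y) = f x * f y) (hf1 : f 1 = 1) {κ : InfinitePlace k → GA W}
    (hκ : ∀ w, ofPlace W w (κ w) ∈ H) (s : Finset (InfinitePlace k)) :
    assembleOn W s κ ∈ H ∧ f (assembleOn W s κ) = ∏ w ∈ s, f (ofPlace W w (κ w)) := by
  induction s using Finset.induction_on with
  | empty =>
    rw [assembleOn_empty, Finset.prod_empty, hf1]
    exact ⟨H.one_mem, rfl⟩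
  | insert a s ha ih =>
    rw [assembleOn_insert W ha, Finset.prod_insert ha]
    exact ⟨H.mul_mem (hκ a) ih.1, by rw [hf _ (hκ a) _ ih.1, ih.2]⟩

/-- Slicing twice at the same place is slicing once. -/
theorem ofPlace_ofPlace (w : InfinitePlace k) (g : GA W) : ofPlace W w (ofPlace W w g) = ofPlace W w g := by
  apply GA.ext_of_components
  · intro w'
    by_cases h : w' = w
    · subst h
      rw [infiniteComponent_ofPlace_self]
    · rw [infiniteComponent_ofPlace_of_ne W h, infiniteComponent_ofPlace_of_ne W h]
  · intro v
    rw [ofPlace, finiteComponent_assemble, ofPlace, finiteComponent_assemble]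

/-- **The product formula**: `f (assemble κ) = ∏ w, f (ofPlace w (κ w))` for `f` multiplicative on a subgroup
containing the slices. -/
theorem map_assemble_eq_prod {M : Type} [CommMonoid M] (H : Subgroup (GA W)) (f : GA W → M)
    (hf : ∀ x ∈ H, ∀ y ∈ H, f (x * y) = f x * f y) (hf1 : f 1 = 1) {κ : InfinitePlace k → GA W}
    (hκ : ∀ w, ofPlace W w (κ w) ∈ H) : f (assemble W κ) = ∏ w, f (ofPlace W w (κ w)) := by
  rw [← assembleOn_univ]
  exact (mem_and_map_assembleOn_eq_prod W H f hf hf1 hκ Finset.univ).2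

/-- **The place split of a value**: for `g ∈ G_∞`, `f g = ∏ w, f (ofPlace w g)`. -/
theorem map_eq_prod_ofPlace_of_mem_infinitePart {M : Type} [CommMonoid M] (H : Subgroup (GA W)) (f : GA W → M)
    (hf : ∀ x ∈ H, ∀ y ∈ H, f (x * y) = f x * f y) (hf1 : f 1 = 1) {g : GA W} (hg : g ∈ infinitePart W)
    (hgw : ∀ w, ofPlace W w g ∈ H) : f g = ∏ w, f (ofPlace W w g) := by
  conv_lhs => rw [← assemble_ofPlace W hg]
  have h := map_assemble_eq_prod W H f hf hf1 (κ := fun w => ofPlace W w g)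
    (fun w => by rw [ofPlace_ofPlace]; exact hgw w)
  simp only [ofPlace_ofPlace] at h
  exact h

/-- **The place split of a character on a subgroup closed under slices** (`χ : H →* M`). -/
theorem map_subtype_eq_prod_ofPlace {M : Type} [CommMonoid M] (H : Subgroup (GA W))
    (hH : ∀ w : InfinitePlace k, ∀ g ∈ H, ofPlace W w g ∈ H) (χ : H →* M) {g : GA W} (hg : g ∈ infinitePart W)
    (hg' : g ∈ H) : χ ⟨g, hg'⟩ = ∏ w, χ ⟨ofPlace W w g, hH w g hg'⟩ := by
  let f : GA W → M := fun x => if h : x ∈ H then χ ⟨x, h⟩ else 1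
  have hf : ∀ x ∈ H, ∀ y ∈ H, f (x * y) = f x * f y := by
    intro x hx y hy
    simp only [f, dif_pos hx, dif_pos hy, dif_pos (H.mul_mem hx hy)]
    exact χ.map_mul ⟨x, hx⟩ ⟨y, hy⟩
  have hf1 : f 1 = 1 := by
    simp only [f, dif_pos H.one_mem]
    exact χ.map_one
  have h := map_eq_prod_ofPlace_of_mem_infinitePart W H f hf hf1 hg (fun w => hH w g hg')
  simp only [f, dif_pos hg', dif_pos (hH _ g hg')] at h
  exact h

/-- **The place split of a character of `T′(𝔸)` on `T′_∞`**: `χ′ t' = ∏ w, χ′ (ofPlace w t')`. -/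
theorem map_subtype_eq_prod_ofPlace_torusT' {M : Type} [CommMonoid M] (χ : torusT' W →* M) {g : GA W}
    (hg : g ∈ infinitePart W) (hg' : g ∈ torusT' W) :
    χ ⟨g, hg'⟩ = ∏ w, χ ⟨ofPlace W w g, ofPlace_mem_torusT' W w hg'⟩ :=
  map_subtype_eq_prod_ofPlace W (torusT' W) (fun w _ h => ofPlace_mem_torusT' W w h) χ hg hg'

/-- **The place split of a character of `T(𝔸)` on `T_∞`**: `χ t = ∏ w, χ (ofPlace w t)`. -/
theorem map_subtype_eq_prod_ofPlace_torusT {M : Type} [CommMonoid M] (χ : torusT W →* M) {g : GA W}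
    (hg : g ∈ infinitePart W) (hg' : g ∈ torusT W) :
    χ ⟨g, hg'⟩ = ∏ w, χ ⟨ofPlace W w g, ofPlace_mem_torusT W w hg'⟩ :=
  map_subtype_eq_prod_ofPlace W (torusT W) (fun w _ h => ofPlace_mem_torusT W w h) χ hg hg'

end Prod

end Summit.Ventures.HodgeRepro.Tier4.Common

end
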